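import Mathlib.NumberTheory.DirichletCharacter.GaussSum
import Mathlib.NumberTheory.Padics.RingHoms
import Mathlib.Analysis.Fourier.ZMod
import Literature.NumberTheory.Automorphic.GL2NewvectorExistence
import HarnessLib

/-!
# A character of `ℤ_pˣ` of conductor exactly `p^n` (`n ≥ 1`) has non-vanishing Gauss sum mod `p^n`

Topic `NumberTheory/GaussSums`; PROOFS file (theorems only: no definition, no named fact, no instance —
D-0026 net debt 0).

A multiplicative character `ψ : MulChar ℤ_[p] ℂ` (i.e. a character of `ℤ_pˣ`, extended by `0`) which is
trivial on the higher unit group `U^{(n)} = 1 + p^n ℤ_p` descends to a Dirichlet character `ψₙ` mod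
`p^n` (`exists_dirichletCharacter_apply_toZModPow_eq`); if moreover `ψ` is NOT trivial on
`U^{(n-1)}` — i.e. `p^n` is the CONDUCTOR of `ψ` (Tate's thesis §2.3: "selecting `ν` minimal … we call
`𝔣 = 𝔭^ν` the conductor"; Neukirch VII (6.10)) — then `ψₙ` is PRIMITIVE
(`isPrimitive_of_apply_toZModPow_eq`), so its Gauss sum against `e^{2πi·/p^n}` has absolute value
`p^{n/2}`, in particular is non-zero (`gaussSum_ne_zero_of_conductor`; tree
`DirichletCharacter.IsPrimitive.gaussSum_stdAddChar_ne_zero`). Read as a sum over the natural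
representatives `0 ≤ k < p^n` (`sum_range_mul_stdAddChar_ne_zero_of_conductor`):
`Σ_{k < p^n} ψ(k) e^{2πik/p^n} ≠ 0`.

This is the local computation behind Disegni's Definition 4 ("`χ_w` is not exceptional if
`Z_w(χ_w) ≠ 0`", Compos. Math. 153 (2017), arXiv:1510.02114 p. 7 L50): in the RAMIFIED branch
`Z_w = τ(χ̃_w, ψ_{E_w}) = ∫_{w(t) = −w(𝔣)} χ̃_w(t) ψ_{E_w}(t) dt` is (a unit multiple of) the Gauss sum of
the conductor-`𝔣` character `χ̃_w|_{𝒪_w^×}` mod `𝔣 = 𝔭_w^n`, `𝒪_w = ℤ_p` at a split prime — never `0`.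
So a ramified `χ_w` is never exceptional (BSD cell `bsd-print-cf2`, road (C), entry ticket §2; typer
file `Disegni2017/ChiLineRankinSelberg.lean` names `localGaussSum (unitCharacter χ w e) (conductorExponentAt χ w)`).
Nothing about BSD is proved here; the statements are about `ℤ_[p]`, `ZMod (p^n)` and `ℂ` only.

## Main statements (all `p` prime, `n ≥ 1`; the §1 reduction lemmas are private plumbing)

* `exists_dirichletCharacter_apply_toZModPow_eq` — `ψ` trivial on `1 + p^n ℤ_p` ⇒
  `∃ ψₙ : DirichletCharacter ℂ (p^n), ∀ x, ψₙ (x mod p^n) = ψ x`.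
* `isPrimitive_of_apply_toZModPow_eq` — if in addition `ψ(u) ≠ 1` for some `u ≡ 1 (mod p^{n-1})`,
  every such `ψₙ` is primitive.
* `gaussSum_ne_zero_of_conductor`, `sum_range_mul_stdAddChar_ne_zero_of_conductor` — the Gauss sum
  mod `p^n` does not vanish.

## References

* J. Tate, *Fourier analysis in number fields and Hecke's zeta-functions* (1950/1967), §2.3
  (conductor of a local quasi-character), §2.5 (the local `ρ`-factor of a ramified character is a
  Gauss sum of absolute value `N𝔣^{1/2}`). [TateThesis1967]
* J. Neukirch, *Algebraic Number Theory* (1999), Ch. VII §6 (6.10)–(6.11); Ch. VII §2 Prop. (2.6)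
  (`|τ(χ)| = √N(𝔣)` for primitive `χ`). [NeukirchANT1999]
* D. Disegni, Compos. Math. 153 (2017), Thm A (`Z_w`, `τ`) and Def. 4 (arXiv:1510.02114 pp. 6–7).
  [Disegni2017]
-/

noncomputable section

open scoped Classical

namespace Literature.NumberTheory.GaussSums

variable {p : ℕ} [hp : Fact p.Prime]

/-! ### §1 Units of `ℤ_p` and reduction mod `p^n` -/

/-- A natural number prime to `p` is a unit of `ℤ_p` (private plumbing). [folklore] -/
private theorem isUnit_natCast_padicInt_of_coprime {k : ℕ} (hk : p.Coprime k) : IsUnit (k : ℤ_[p]) :=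
  PadicInt.isUnit_iff.mpr (PadicInt.norm_natCast_eq_one_iff.mpr hk)

/-- **`ℤ_pˣ → (ℤ/p^n)ˣ` is onto** (`n` arbitrary): the natural representative `k < p^n` of a unit
mod `p^n` is prime to `p`, hence a unit of `ℤ_p`, and reduces to it. [folklore] -/
private theorem unitsMap_toZModPow_surjective (n : ℕ) (hn : n ≠ 0) :
    Function.Surjective (Units.map (PadicInt.toZModPow n : ℤ_[p] →+* ZMod (p ^ n)).toMonoidHom) := by
  intro a
  set k : ℕ := (a : ZMod (p ^ n)).val with hk
  have hkcop : k.Coprime (p ^ n) := ZMod.val_coe_unit_coprime a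
  have hpk : p.Coprime k := (Nat.Coprime.coprime_dvd_right (dvd_pow_self p hn) hkcop).symm
  obtain ⟨u, hu⟩ := isUnit_natCast_padicInt_of_coprime hpk
  refine ⟨u, Units.ext ?_⟩
  change PadicInt.toZModPow n (u : ℤ_[p]) = (a : ZMod (p ^ n))
  rw [hu, map_natCast, hk, ZMod.natCast_zmod_val]

/-- A unit `u` of `ℤ_p` with `u ≡ 1 (mod p^n)` in norm form, `‖u − 1‖ ≤ p^{−n}`, reduces to `1` mod
`p^n`. [folklore] -/
private theorem toZModPow_eq_one_of_norm_sub_one_le {n : ℕ} {u : ℤ_[p]}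
    (hu : ‖u - 1‖ ≤ (p : ℝ) ^ (-(n : ℤ))) : PadicInt.toZModPow n u = 1 := by
  have hmem : u - 1 ∈ Ideal.span {(p : ℤ_[p]) ^ n} :=
    (PadicInt.norm_le_pow_iff_mem_span_pow _ _).mp hu
  rw [← PadicInt.ker_toZModPow, RingHom.mem_ker, map_sub, map_one, sub_eq_zero] at hmem
  exact hmem

/-- Conversely, `u ≡ 1 (mod p^n)` gives `‖u − 1‖ ≤ p^{−n}`. [folklore] -/
private theorem norm_sub_one_le_of_toZModPow_eq_one {n : ℕ} {u : ℤ_[p]}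
    (hu : PadicInt.toZModPow n u = 1) : ‖u - 1‖ ≤ (p : ℝ) ^ (-(n : ℤ)) := by
  have hmem : u - 1 ∈ RingHom.ker (PadicInt.toZModPow n : ℤ_[p] →+* ZMod (p ^ n)) := by
    rw [RingHom.mem_ker, map_sub, map_one, hu, sub_self]
  rw [PadicInt.ker_toZModPow] at hmem
  exact (PadicInt.norm_le_pow_iff_mem_span_pow _ _).mpr hmem

/-- A non-unit of `ℤ_p` reduces to a non-unit mod `p^n` (`n ≥ 1`): it is divisible by `p`, and `p`
is not a unit mod `p^n`. [folklore] -/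
private theorem not_isUnit_toZModPow_of_not_isUnit {n : ℕ} (hn : n ≠ 0) {x : ℤ_[p]} (hx : ¬ IsUnit x) :
    ¬ IsUnit (PadicInt.toZModPow n x) := by
  have hlt : ‖x‖ < 1 := lt_of_le_of_ne x.norm_le_one (fun h => hx (PadicInt.isUnit_iff.mpr h))
  obtain ⟨y, rfl⟩ := (PadicInt.norm_lt_one_iff_dvd x).mp hlt
  intro hunit
  rw [map_mul, map_natCast] at hunit
  have hpunit : IsUnit ((p : ℕ) : ZMod (p ^ n)) := isUnit_of_mul_isUnit_left hunit
  rw [ZMod.isUnit_iff_coprime, Nat.coprime_pow_right_iff (Nat.pos_of_ne_zero hn),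
    Nat.coprime_self] at hpunit
  exact hp.out.one_lt.ne' hpunit

/-! ### §2 Descent of a character of `ℤ_pˣ` trivial on `1 + p^n ℤ_p` to a Dirichlet character mod `p^n` -/

/-- **A character of `ℤ_pˣ` trivial on `U^{(n)} = 1 + p^n ℤ_p` is a Dirichlet character mod `p^n`**
(`n ≥ 1`): there is `ψₙ : DirichletCharacter ℂ (p^n)` with `ψₙ(x mod p^n) = ψ(x)` for every
`x ∈ ℤ_p` (units: `ℤ_pˣ/U^{(n)} ≅ (ℤ/p^n)ˣ`; non-units go to non-units, both sides `0`). Tate §2.3 /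
Neukirch VII (6.10): a character trivial on `U^{(n)}` "is a character of `U/U^{(n)}`".
[cite: TateThesis1967, §2.3] [cite: NeukirchANT1999, Ch. VII §6 (6.10)] -/
theorem exists_dirichletCharacter_apply_toZModPow_eq (ψ : MulChar ℤ_[p] ℂ) {n : ℕ} (hn : n ≠ 0)
    (htriv : ∀ u : ℤ_[p]ˣ, ‖(u : ℤ_[p]) - 1‖ ≤ (p : ℝ) ^ (-(n : ℤ)) → ψ u = 1) :
    ∃ ψₙ : DirichletCharacter ℂ (p ^ n), ∀ x : ℤ_[p], ψₙ (PadicInt.toZModPow n x) = ψ x := by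
  set π : ℤ_[p]ˣ →* (ZMod (p ^ n))ˣ :=
    (Units.map (PadicInt.toZModPow n : ℤ_[p] →+* ZMod (p ^ n)).toMonoidHom) with hπ
  have hsurj : Function.Surjective π := unitsMap_toZModPow_surjective n hn
  -- `ker π ≤ ker ψ|_{ℤ_pˣ}`
  have hker : π.ker ≤ (MulChar.toUnitHom ψ).ker := by
    intro u hu
    rw [MonoidHom.mem_ker] at hu ⊢
    have hu1 : PadicInt.toZModPow n (u : ℤ_[p]) = 1 := by
      have h := congrArg (fun z : (ZMod (p ^ n))ˣ => (z : ZMod (p ^ n))) hu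
      simpa [hπ] using h
    have h := htriv u (norm_sub_one_le_of_toZModPow_eq_one hu1)
    exact Units.ext (by rw [MulChar.coe_toUnitHom]; exact h)
  set φ : (ZMod (p ^ n))ˣ →* ℂˣ := MonoidHom.liftOfSurjective π hsurj ⟨MulChar.toUnitHom ψ, hker⟩
    with hφ
  have hφπ : ∀ u : ℤ_[p]ˣ, φ (π u) = MulChar.toUnitHom ψ u := fun u =>
    MonoidHom.liftOfRightInverse_comp_apply π _ _ ⟨MulChar.toUnitHom ψ, hker⟩ u
  refine ⟨MulChar.ofUnitHom φ, fun x => ?_⟩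
  by_cases hx : IsUnit x
  · obtain ⟨u, rfl⟩ := hx
    have hπu : ((π u : (ZMod (p ^ n))ˣ) : ZMod (p ^ n)) = PadicInt.toZModPow n (u : ℤ_[p]) := by
      simp [hπ]
    rw [← hπu, MulChar.ofUnitHom_coe, hφπ u, MulChar.coe_toUnitHom]
  · rw [MulChar.map_nonunit _ (not_isUnit_toZModPow_of_not_isUnit hn hx), MulChar.map_nonunit _ hx]

/-- **Minimality ⇒ primitivity.** If `ψₙ : DirichletCharacter ℂ (p^n)` agrees with `ψ` through
reduction mod `p^n` and `ψ` is NOT trivial on `U^{(n−1)} = 1 + p^{n−1}ℤ_p` (so `p^n` is the exact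
conductor of `ψ`, Tate §2.3), then `ψₙ` is primitive: were `cond ψₙ = p^j` with `j < n`, `ψₙ` would kill
`ker((ℤ/p^n)ˣ → (ℤ/p^j)ˣ)` (Mathlib `factorsThrough_iff_ker_unitsMap`), hence `ψ` would kill
`U^{(j)} ⊇ U^{(n−1)}`. [cite: TateThesis1967, §2.3] [cite: NeukirchANT1999, Ch. VII §6 (6.10)–(6.11)] -/
theorem isPrimitive_of_apply_toZModPow_eq (ψ : MulChar ℤ_[p] ℂ) {n : ℕ}
    {ψₙ : DirichletCharacter ℂ (p ^ n)} (hψₙ : ∀ x : ℤ_[p], ψₙ (PadicInt.toZModPow n x) = ψ x)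
    (hmin : ∃ u : ℤ_[p]ˣ, ‖(u : ℤ_[p]) - 1‖ ≤ (p : ℝ) ^ (-((n - 1 : ℕ) : ℤ)) ∧ ψ u ≠ 1) :
    ψₙ.IsPrimitive := by
  haveI : NeZero (p ^ n) := ⟨pow_ne_zero _ hp.out.ne_zero⟩
  obtain ⟨u, hu, hψu⟩ := hmin
  -- the conductor is `p^j`, `j ≤ n`
  obtain ⟨j, hjn, hj⟩ := (Nat.dvd_prime_pow hp.out).mp (DirichletCharacter.conductor_dvd_level ψₙ)
  by_contra hprim
  have hjlt : j < n := by
    rcases hjn.lt_or_eq with h | h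
    · exact h
    · exact absurd (by rw [DirichletCharacter.IsPrimitive, hj, h]) hprim
  -- `ψₙ` factors through `p^j`
  have hdvd : p ^ j ∣ p ^ n := pow_dvd_pow p hjn
  have hfac : ψₙ.FactorsThrough (p ^ j) := hj ▸ DirichletCharacter.factorsThrough_conductor ψₙ
  rw [DirichletCharacter.factorsThrough_iff_ker_unitsMap hdvd] at hfac
  -- `u mod p^n` lies in the kernel of `(ℤ/p^n)ˣ → (ℤ/p^j)ˣ`
  have huj : ‖(u : ℤ_[p]) - 1‖ ≤ (p : ℝ) ^ (-(j : ℤ)) := by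
    refine hu.trans (zpow_le_zpow_right₀ (by exact_mod_cast hp.out.one_lt.le) ?_)
    omega
  set x : (ZMod (p ^ n))ˣ := Units.map (PadicInt.toZModPow n : ℤ_[p] →+* ZMod (p ^ n)).toMonoidHom u
    with hx
  have hxker : x ∈ (ZMod.unitsMap hdvd).ker := by
    rw [MonoidHom.mem_ker]
    refine Units.ext ?_
    rw [ZMod.unitsMap_val, Units.val_one]
    change ZMod.cast (PadicInt.toZModPow n (u : ℤ_[p])) = (1 : ZMod (p ^ j))
    rw [PadicInt.cast_toZModPow j n hjn, toZModPow_eq_one_of_norm_sub_one_le huj]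
  have h1 := hfac hxker
  rw [MonoidHom.mem_ker, Units.ext_iff, MulChar.coe_toUnitHom, Units.val_one] at h1
  change ψₙ (PadicInt.toZModPow n (u : ℤ_[p])) = 1 at h1
  rw [hψₙ] at h1
  exact hψu h1

/-! ### §3 The Gauss sum mod `p^n` of a character of conductor `p^n` does not vanish -/

/-- **Non-vanishing of the Gauss sum of a character of `ℤ_pˣ` of conductor exactly `p^n`** (`n ≥ 1`),
Dirichlet-character form: for every `ψₙ` mod `p^n` through which `ψ` descends,
`g(ψₙ, e^{2πi·/p^n}) ≠ 0` (`ψₙ` is primitive, so `|g|² = p^n`; Tate §2.5 / Neukirch VII (2.6)).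
[cite: TateThesis1967, §2.5] [cite: NeukirchANT1999, Ch. VII §2 Prop. (2.6)] -/
theorem gaussSum_ne_zero_of_conductor (ψ : MulChar ℤ_[p] ℂ) {n : ℕ}
    {ψₙ : DirichletCharacter ℂ (p ^ n)} (hψₙ : ∀ x : ℤ_[p], ψₙ (PadicInt.toZModPow n x) = ψ x)
    (hmin : ∃ u : ℤ_[p]ˣ, ‖(u : ℤ_[p]) - 1‖ ≤ (p : ℝ) ^ (-((n - 1 : ℕ) : ℤ)) ∧ ψ u ≠ 1) :
    gaussSum ψₙ (ZMod.stdAddChar (N := p ^ n)) ≠ 0 := by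
  haveI : NeZero (p ^ n) := ⟨pow_ne_zero _ hp.out.ne_zero⟩
  exact Literature.NumberTheory.Automorphic.DirichletCharacter.IsPrimitive.gaussSum_stdAddChar_ne_zero
    (isPrimitive_of_apply_toZModPow_eq ψ hψₙ hmin)

/-- **Summing over representatives**: `Σ_{a ∈ ℤ/N} f(a) = Σ_{k < N} f(k mod N)`. [folklore] -/
private theorem sum_univ_zmod_eq_sum_range {N : ℕ} [NeZero N] {M : Type*} [AddCommMonoid M]
    (f : ZMod N → M) : ∑ a : ZMod N, f a = ∑ k ∈ Finset.range N, f (k : ZMod N) := by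
  refine (Finset.sum_nbij' (fun k : ℕ => (k : ZMod N)) (fun a : ZMod N => a.val) ?_ ?_ ?_ ?_ ?_).symm
  · intro k _; exact Finset.mem_univ _
  · intro a _; exact Finset.mem_range.mpr (ZMod.val_lt a)
  · intro k hk; exact ZMod.val_cast_of_lt (Finset.mem_range.mp hk)
  · intro a _; exact ZMod.natCast_zmod_val a
  · intro k _; rfl

/-- **`Σ_{k < p^n} ψ(k) e^{2πik/p^n} ≠ 0`** for a character `ψ` of `ℤ_pˣ` (extended by `0` to `ℤ_p`)
of conductor exactly `p^n`, `n ≥ 1`: trivial on `1 + p^n ℤ_p`, non-trivial on `1 + p^{n−1}ℤ_p`. The sum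
is the Gauss sum of the primitive Dirichlet character `ψₙ` mod `p^n` induced by `ψ` (§2) against the
standard additive character `k ↦ e^{2πik/p^n}` (Mathlib `ZMod.stdAddChar`). This is the content of
"a RAMIFIED local character is never exceptional" in Disegni's Definition 4 (the ramified branch of
`Z_w` is this Gauss sum up to a unit). [cite: TateThesis1967, §2.3 and §2.5]
[cite: NeukirchANT1999, Ch. VII §2 Prop. (2.6)] [cite: Disegni2017, Theorem A (Z_w) and Def. 4 (arXiv:1510.02114 pp. 6–7)] -/
theorem sum_range_mul_stdAddChar_ne_zero_of_conductor (ψ : MulChar ℤ_[p] ℂ) {n : ℕ} (hn : n ≠ 0)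
    (htriv : ∀ u : ℤ_[p]ˣ, ‖(u : ℤ_[p]) - 1‖ ≤ (p : ℝ) ^ (-(n : ℤ)) → ψ u = 1)
    (hmin : ∃ u : ℤ_[p]ˣ, ‖(u : ℤ_[p]) - 1‖ ≤ (p : ℝ) ^ (-((n - 1 : ℕ) : ℤ)) ∧ ψ u ≠ 1) :
    ∑ k ∈ Finset.range (p ^ n), ψ (k : ℤ_[p]) * ZMod.stdAddChar (N := p ^ n) (k : ZMod (p ^ n)) ≠ 0 := by
  haveI : NeZero (p ^ n) := ⟨pow_ne_zero _ hp.out.ne_zero⟩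
  obtain ⟨ψₙ, hψₙ⟩ := exists_dirichletCharacter_apply_toZModPow_eq ψ hn htriv
  have hne := gaussSum_ne_zero_of_conductor ψ hψₙ hmin
  have hsum : gaussSum ψₙ (ZMod.stdAddChar (N := p ^ n)) =
      ∑ k ∈ Finset.range (p ^ n), ψ (k : ℤ_[p]) * ZMod.stdAddChar (N := p ^ n) (k : ZMod (p ^ n)) := by
    rw [gaussSum, sum_univ_zmod_eq_sum_range]
    refine Finset.sum_congr rfl fun k _ => ?_
    rw [← map_natCast (PadicInt.toZModPow n : ℤ_[p] →+* ZMod (p ^ n)) k, hψₙ]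
  rwa [hsum] at hne

/-- The same with the additive character written as a complex exponential:
`Σ_{k < p^n} ψ(k) exp(2πi k/p^n) ≠ 0`. [cite: TateThesis1967, §2.5] [cite: NeukirchANT1999, Ch. VII §2 Prop. (2.6)] -/
theorem sum_range_mul_exp_ne_zero_of_conductor (ψ : MulChar ℤ_[p] ℂ) {n : ℕ} (hn : n ≠ 0)
    (htriv : ∀ u : ℤ_[p]ˣ, ‖(u : ℤ_[p]) - 1‖ ≤ (p : ℝ) ^ (-(n : ℤ)) → ψ u = 1)
    (hmin : ∃ u : ℤ_[p]ˣ, ‖(u : ℤ_[p]) - 1‖ ≤ (p : ℝ) ^ (-((n - 1 : ℕ) : ℤ)) ∧ ψ u ≠ 1) :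
    ∑ k ∈ Finset.range (p ^ n),
      ψ (k : ℤ_[p]) * Complex.exp (2 * Real.pi * Complex.I * k / (p ^ n : ℕ)) ≠ 0 := by
  have h := sum_range_mul_stdAddChar_ne_zero_of_conductor ψ hn htriv hmin
  have hrw : ∀ k : ℕ, ZMod.stdAddChar (N := p ^ n) (k : ZMod (p ^ n)) =
      Complex.exp (2 * Real.pi * Complex.I * k / (p ^ n : ℕ)) := by
    intro k
    rw [← Int.cast_natCast k, ZMod.stdAddChar_coe, Int.cast_natCast]
  simp_rw [hrw] at h
  exact h

end Literature.NumberTheory.GaussSums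

end
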